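/-
Copyright: derived here (Resolution Observatory cell `pub-rosobs`, carver gen 60). AI-written Lean; AI review is
weaker than expert review.  Companion file of the cell's POLYNOMIAL weighted-centre model `W(f)` (engine 1's
`W(f)` / (P)-system TOY MODEL; CARVER-NOTES-eng1-g40 **T80 (e)** = THEOREM-F §4b step L4′: "for `e ≠ 0` every
linear form `L` is `∂_e Q` for some quadratic form `Q`", characteristic `≠ 2`).
Instrument — NOT a resolution theorem and NOT a statement about the invariant of [AbramovichTemkinWlodarczyk2024].
-/
import Literature.AlgebraicGeometry.Resolution.WeightedCentreInvariantDirection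
import HarnessLib

/-!
# Every linear form is the directional derivative of a quadratic form along a non-zero direction (`2 ≠ 0`)

Language of `WeightedCentreInvariantDirection` (§ Quadratic): quadratic forms `q = Σ_{i,j∈S} b_{ij} X_i X_j` with a
symmetric table `b`, shifted generic point `lineShift e q = q(X + t e) = q + 2B(X,e)·t + q(e)·t²`
(`lineShift_quadraticForm`, `polar_eq_linearForm`).  THEOREM-F §4b, L4′ (the one step of THEOREM L-F₁ special to
`p = 3`) needs: for a direction `e` with some `e_{t₀} ≠ 0` (`t₀ ∈ S`) and ANY linear form `L = Σ_{i∈S} l_i X_i` there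
is such a `q` with `t`-coefficient `L`, i.e. "`∂_e q = L`".  The text's recipe — `φ` linear with `φ(e) = 1`,
`q := Lφ` if `L(e) = 0`, `q := L²/(2L(e))` otherwise — is typed here in the case-free form
`q := Lφ − (L(e)/2)·φ²`, `φ := X_{t₀}/e_{t₀}`:

* `primitiveTable S e l t₀` — its symmetric table `b_{ij} = (l_iφ_j + l_jφ_i)/2 − (L(e)/2)φ_iφ_j`;
* `two_mul_sum_primitiveTable_mul` — `2·Σ_{j∈S} b_{ij} e_j = l_i` (`i ∈ S`): "`∂_e(Lφ) = L(e)φ + φ(e)L`,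
  `∂_e(φ²) = 2φ(e)φ`";
* `lineShift_primitiveForm` / `exists_quadraticForm_lineShift` — `q(X + t e) = q + L·t + q(e)·t²`.

[Lang2002, Ch. XIII §4 / Ch. XV (bilinear and quadratic forms)] for the polar form; the lemma and its formalisation
are ours (CARVER-NOTES-eng1-g40 T80 (e)).  [AbramovichTemkinWlodarczyk2024] context only.
-/

namespace Literature.AlgebraicGeometry.Resolution.WeightedBlowup

namespace InvariantDirection

open MvPolynomial

variable {K : Type*} [Field K] {ι : Type*} [DecidableEq ι]

/-- The linear form `φ := X_{t₀}/e_{t₀}` as a coefficient vector (ours, bookkeeping): `φ(e) = 1`.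
[cite: Lang2002, Ch. XIII §4] -/
def dualVector (e : ι → K) (t₀ : ι) : ι → K := Pi.single t₀ (e t₀)⁻¹

/-- `φ(e) = Σ_{j∈S} φ_j e_j = 1` when `t₀ ∈ S` and `e_{t₀} ≠ 0` (ours). [cite: Lang2002, Ch. XIII §4] -/
theorem sum_dualVector_mul (S : Finset ι) (e : ι → K) {t₀ : ι} (ht₀ : t₀ ∈ S) (he : e t₀ ≠ 0) :
    ∑ j ∈ S, dualVector e t₀ j * e j = 1 := by
  rw [Finset.sum_eq_single_of_mem t₀ ht₀]
  · rw [dualVector, Pi.single_eq_same, inv_mul_cancel₀ he]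
  · intro j _ hj
    rw [dualVector, Pi.single_eq_of_ne hj, zero_mul]

/-- **L4′'s symmetric table** (ours): `b_{ij} := (l_iφ_j + l_jφ_i)/2 − (L(e)/2)·φ_iφ_j`, the table of the quadratic form
`q = Lφ − (L(e)/2)φ²` (`L = Σ l_i X_i`, `L(e) = Σ_{u∈S} l_u e_u`, `φ = dualVector e t₀`). [cite: Lang2002, Ch. XIII §4] -/
def primitiveTable (S : Finset ι) (e l : ι → K) (t₀ : ι) : ι → ι → K := fun i j =>
  (l i * dualVector e t₀ j + l j * dualVector e t₀ i) / 2
    - (∑ u ∈ S, l u * e u) / 2 * dualVector e t₀ i * dualVector e t₀ j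

/-- The table is symmetric (ours). [cite: Lang2002, Ch. XIII §4] -/
theorem primitiveTable_symm (S : Finset ι) (e l : ι → K) (t₀ : ι) (i j : ι) :
    primitiveTable S e l t₀ i j = primitiveTable S e l t₀ j i := by
  unfold primitiveTable
  ring

/-- **`∂_e q = L`** at the level of tables (derived here): `2·Σ_{j∈S} b_{ij} e_j = l_i` for `i ∈ S` — the computation
"`∂_e(Lφ) = L(e)φ + φ(e)L = L(e)φ + L`, `∂_e((L(e)/2)φ²) = L(e)φ(e)φ = L(e)φ`" (`2 ≠ 0`, `φ(e) = 1`).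
[cite: Lang2002, Ch. XIII §4] -/
theorem two_mul_sum_primitiveTable_mul (h2 : (2 : K) ≠ 0) (S : Finset ι) (e l : ι → K) {t₀ : ι} (ht₀ : t₀ ∈ S)
    (he : e t₀ ≠ 0) (i : ι) : 2 * ∑ j ∈ S, primitiveTable S e l t₀ i j * e j = l i := by
  have hφ := sum_dualVector_mul S e ht₀ he
  have hsplit : ∑ j ∈ S, primitiveTable S e l t₀ i j * e j
      = l i / 2 * ∑ j ∈ S, dualVector e t₀ j * e j
        + dualVector e t₀ i / 2 * ∑ j ∈ S, l j * e j
        - (∑ u ∈ S, l u * e u) / 2 * dualVector e t₀ i * ∑ j ∈ S, dualVector e t₀ j * e j := by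
    rw [Finset.mul_sum, Finset.mul_sum, Finset.mul_sum, ← Finset.sum_add_distrib, ← Finset.sum_sub_distrib]
    refine Finset.sum_congr rfl fun j _ => ?_
    unfold primitiveTable
    ring
  rw [hsplit, hφ, mul_one, mul_one]
  field_simp
  ring

/-- **L4′: `q(X + t e) = q(X) + L·t + q(e)·t²`** for `q` the quadratic form of `primitiveTable S e l t₀` and
`L = Σ_{i∈S} l_i X_i` (derived here; `2 ≠ 0`, `t₀ ∈ S`, `e_{t₀} ≠ 0`). [cite: Lang2002, Ch. XIII §4] -/
theorem lineShift_primitiveForm (h2 : (2 : K) ≠ 0) (S : Finset ι) (e l : ι → K) {t₀ : ι} (ht₀ : t₀ ∈ S)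
    (he : e t₀ ≠ 0) :
    lineShift e (∑ i ∈ S, ∑ j ∈ S, C (primitiveTable S e l t₀ i j) * X i * X j)
      = Polynomial.C (∑ i ∈ S, ∑ j ∈ S, C (primitiveTable S e l t₀ i j) * X i * X j)
        + Polynomial.C (∑ i ∈ S, C (l i) * X i) * Polynomial.X
        + Polynomial.C (C (∑ i ∈ S, ∑ j ∈ S, primitiveTable S e l t₀ i j * e i * e j)) * Polynomial.X ^ 2 := by
  have hL : (∑ i ∈ S, C (2 * ∑ j ∈ S, primitiveTable S e l t₀ i j * e j) * X i : MvPolynomial ι K)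
      = ∑ i ∈ S, C (l i) * X i :=
    Finset.sum_congr rfl fun i _ => by rw [two_mul_sum_primitiveTable_mul h2 S e l ht₀ he i]
  rw [lineShift_quadraticForm, polar_eq_linearForm S _ (primitiveTable_symm S e l t₀) e, hL]

/-- **L4′ (THEOREM-F §4b): for `e ≠ 0` on `S`, every linear form `Σ_{i∈S} l_i X_i` is the `t`-coefficient of
`q(X + t e)` for some quadratic form `q = Σ_{i,j∈S} b_{ij} X_i X_j` with symmetric `b`** (derived here; `2 ≠ 0`).
[cite: Lang2002, Ch. XIII §4] -/
theorem exists_quadraticForm_lineShift (h2 : (2 : K) ≠ 0) (S : Finset ι) (e l : ι → K) {t₀ : ι} (ht₀ : t₀ ∈ S)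
    (he : e t₀ ≠ 0) :
    ∃ b : ι → ι → K, (∀ i j, b i j = b j i) ∧ ∃ c : K,
      lineShift e (∑ i ∈ S, ∑ j ∈ S, C (b i j) * X i * X j)
        = Polynomial.C (∑ i ∈ S, ∑ j ∈ S, C (b i j) * X i * X j)
          + Polynomial.C (∑ i ∈ S, C (l i) * X i) * Polynomial.X + Polynomial.C (C c) * Polynomial.X ^ 2 :=
  ⟨primitiveTable S e l t₀, primitiveTable_symm S e l t₀, _, lineShift_primitiveForm h2 S e l ht₀ he⟩

end InvariantDirection

end Literature.AlgebraicGeometry.Resolution.WeightedBlowup
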